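import Literature.NumberTheory.EllipticCurves.SupersingularTateModuleFormalGroup
import HarnessLib

/-!
# The dictionary `E₁(K) ≅ Ŵ(𝔪_K)` and the Tate-module map commute with automorphisms of `K` fixing the coefficients

Topic `Literature/NumberTheory/EllipticCurves`; sequel of `FormalGroupNilIdealPoints` (§4 naturality), `…GroupIso`,
`SupersingularTateModuleFormalGroup`. For a ring endomorphism `σ` of the complete ultrametric field `K` with `‖σ x‖ = ‖x‖`, restricting
on `𝒪_K` to a continuous `A`-algebra map `ε` (so `σ` fixes the coefficients of `W`):

* `galPointHom σ hσ : E(K) →+ E(K)`, `(x, y) ↦ (σ x, σ y)` (the tree's `mapPointHom` followed by the transport along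
  `(curveOver K W).map σ = curveOver K W`), preserving `E₁(K)` (`galPointHom_mem_kernel`);
* **`zPt_galPointHom`**: `z(σ P) = ε(z(P))`, i.e. the isomorphism `kernelEquivPt : E₁(K) ≃+ Ŵ(𝔪_K)` intertwines `galPointHom σ` with
  `WeierstrassCurve.Pt.map ε` (`kernelEquivPt_galPointHom`);
* **`tateModuleToPt_map_galPointHom`**: `T_p(σ) ∘ tateModuleToPt = tateModuleToPt ∘ T_p(σ)` — the matching
  `T_p E(K) → T_p Ŵ(𝔪_K)` of `SupersingularTateModuleFormalGroup` is equivariant (for `K = ℂ_F`, `σ ∈ Γ_F`, `W/ℤ`: the right-hand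
  action is `galPt` of `PAdicHodge/AinfWeierstrassTateModule`).

BSD / K★ (`Cruxes/StarredOptimalManinUnitFiveSeven/Lines/kato-lever-hDR-sector-iii-periods.md` §5 (M2)): infrastructure; nothing about
elliptic curves over number fields is proved here.

## References
* J. H. Silverman, *The Arithmetic of Elliptic Curves* (2009), III.§7, Prop. VII.2.2. [SilvermanAEC2009]
-/

noncomputable section

open scoped Classical NNReal

namespace Literature.NumberTheory.EllipticCurves

open Literature.NumberTheory.GaloisRepresentations.LubinTate
open Literature.NumberTheory.EllipticCurves.FormalGroupChart _root_.WeierstrassCurve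

section Galois

variable {A : Type*} [CommRing A] [UniformSpace A] [DiscreteUniformity A]
  {K : Type*} [NontriviallyNormedField K] [IsUltrametricDist K] [CompleteSpace K]
  [Algebra A (unitBall K)] [ContinuousSMul A (unitBall K)] {W : WeierstrassCurve A}

omit [UniformSpace A] [DiscreteUniformity A] [CompleteSpace K] [ContinuousSMul A (unitBall K)] in
/-- A ring endomorphism of `K` fixing the images of the coefficients fixes the curve `E = W ⊗ K`. [cite: SilvermanAEC2009, III.§1] -/
theorem curveOver_map_of_fix (σ : K →+* K) (hσA : ∀ a : A, σ (cK K a) = cK K a) : (curveOver K W).map σ = curveOver K W := by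
  obtain ⟨h₁, h₂, h₃, h₄, h₆⟩ := curveOver_a (K := K) (W := W)
  ext
  · rw [map_a₁, h₁, hσA]
  · rw [map_a₂, h₂, hσA]
  · rw [map_a₃, h₃, hσA]
  · rw [map_a₄, h₄, hσA]
  · rw [map_a₆, h₆, hσA]

/-- **The action of `σ` on `E(K)`**, `O ↦ O`, `(x, y) ↦ (σ x, σ y)`, for a ring endomorphism `σ` of `K` fixing the coefficients
(the tree's `mapPointHom` followed by `Affine.Point.congrEquiv`). [cite: SilvermanAEC2009, III.§1] -/
def galPointHom (σ : K →+* K) (hσA : ∀ a : A, σ (cK K a) = cK K a) :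
    (curveOver K W).toAffine.Point →+ (curveOver K W).toAffine.Point :=
  (Affine.Point.congrEquiv (curveOver_map_of_fix σ hσA)).toAddMonoidHom.comp ((curveOver K W).mapPointHom σ)

omit [UniformSpace A] [DiscreteUniformity A] [CompleteSpace K] [ContinuousSMul A (unitBall K)] in
/-- `σ O = O`. [cite: SilvermanAEC2009, III.§1] -/
@[simp] theorem galPointHom_zero (σ : K →+* K) (hσA : ∀ a : A, σ (cK K a) = cK K a) :
    galPointHom (W := W) σ hσA 0 = 0 := map_zero _

omit [UniformSpace A] [DiscreteUniformity A] [CompleteSpace K] [ContinuousSMul A (unitBall K)] in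
/-- `σ (x, y) = (σ x, σ y)`. [cite: SilvermanAEC2009, III.§1] -/
theorem galPointHom_some (σ : K →+* K) (hσA : ∀ a : A, σ (cK K a) = cK K a) {x y : K}
    (h : (curveOver K W).toAffine.Nonsingular x y) :
    ∃ h', galPointHom (W := W) σ hσA (.some x y h) = .some (σ x) (σ y) h' := by
  refine ⟨?_, ?_⟩
  · have h2 : ((curveOver K W).map σ).toAffine.Nonsingular (σ x) (σ y) := (Affine.map_nonsingular _ σ.injective x y).mpr h
    rwa [curveOver_map_of_fix σ hσA] at h2
  · change Affine.Point.congrEquiv _ ((curveOver K W).mapPointHom σ (.some x y h)) = _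
    rw [mapPointHom_some, Affine.Point.congrEquiv_some]

omit [UniformSpace A] [DiscreteUniformity A] [CompleteSpace K] [ContinuousSMul A (unitBall K)] in
/-- `z(σ P) = σ(z(P))`. [cite: SilvermanAEC2009, Prop. VII.2.2] -/
theorem zCoord_galPointHom (σ : K →+* K) (hσA : ∀ a : A, σ (cK K a) = cK K a) (P : (curveOver K W).toAffine.Point) :
    (galPointHom (W := W) σ hσA P).zCoord = σ P.zCoord := by
  rcases P with _ | ⟨x, y, h⟩
  · rw [← Affine.Point.zero_def, galPointHom_zero, Affine.Point.zCoord_zero, map_zero]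
  · obtain ⟨h', e⟩ := galPointHom_some (W := W) σ hσA h
    rw [e, Affine.Point.zCoord_some, Affine.Point.zCoord_some, map_div₀, map_neg]

omit [UniformSpace A] [DiscreteUniformity A] [CompleteSpace K] [ContinuousSMul A (unitBall K)] in
/-- An ISOMETRIC `σ` preserves `E₁(K)`. [cite: SilvermanAEC2009, Prop. VII.2.2] -/
theorem galPointHom_mem_kernel (σ : K →+* K) (hσA : ∀ a : A, σ (cK K a) = cK K a) (hiso : ∀ x, ‖σ x‖ = ‖x‖)
    {P : (curveOver K W).toAffine.Point} (hP : P ∈ kernel (NormedField.valuation (K := K)) (curveOver K W)) :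
    galPointHom (W := W) σ hσA P ∈ kernel (NormedField.valuation (K := K)) (curveOver K W) := by
  rcases P with _ | ⟨x, y, h⟩
  · rw [← Affine.Point.zero_def, galPointHom_zero]; exact (kernel (NormedField.valuation (K := K)) (curveOver K W)).zero_mem
  · obtain ⟨h', e⟩ := galPointHom_some (W := W) σ hσA h
    rw [e]
    refine some_mem_kernel _ ?_
    have hx := (some_mem_kernel_iff h).mp hP
    rw [← NNReal.coe_lt_coe, NormedField.valuation_apply, coe_nnnorm] at hx ⊢
    rwa [hiso]

variable [hE : (curveOver K W).IsElliptic]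

omit [UniformSpace A] [DiscreteUniformity A] [CompleteSpace K] [ContinuousSMul A (unitBall K)] in
/-- **`z(σ P) = ε(z(P))` as points of `𝔪_K`**: the parameter of `σ P` is the image of the parameter of `P` under the restriction `ε`
of `σ` to `𝒪_K`. [cite: SilvermanAEC2009, Prop. VII.2.2] -/
theorem zPt_galPointHom (σ : K →+* K) (hσA : ∀ a : A, σ (cK K a) = cK K a) (hiso : ∀ x, ‖σ x‖ = ‖x‖)
    (ε : unitBall K →ₐ[A] unitBall K) (hεm : ∀ x ∈ (ballNilIdeal K).toIdeal, ε x ∈ (ballNilIdeal K).toIdeal)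
    (hφ : ∀ x : unitBall K, σ x = ε x)
    {P : (curveOver K W).toAffine.Point} (hP : P ∈ kernel (NormedField.valuation (K := K)) (curveOver K W)) :
    zPt (galPointHom (W := W) σ hσA P) (galPointHom_mem_kernel σ hσA hiso hP) = mapBallPt ε hεm (zPt P hP) := by
  apply Subtype.ext; apply Subtype.ext
  rw [coe_zPt, zCoord_galPointHom, coe_mapBallPt_zPt ε hεm σ hφ]

/-- **`kernelEquivPt` intertwines `σ` on `E₁(K)` with `Pt.map ε` on `Ŵ(𝔪_K)`.** [cite: SilvermanAEC2009, Prop. VII.2.2] -/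
theorem kernelEquivPt_galPointHom (σ : K →+* K) (hσA : ∀ a : A, σ (cK K a) = cK K a) (hiso : ∀ x, ‖σ x‖ = ‖x‖)
    (ε : unitBall K →ₐ[A] unitBall K) (hε : Continuous ε) (hεm : ∀ x ∈ (ballNilIdeal K).toIdeal, ε x ∈ (ballNilIdeal K).toIdeal)
    (hφ : ∀ x : unitBall K, σ x = ε x)
    (P : kernel (NormedField.valuation (K := K)) (curveOver K W)) :
    kernelEquivPt K W ⟨galPointHom (W := W) σ hσA P, galPointHom_mem_kernel σ hσA hiso P.2⟩ =
      WeierstrassCurve.Pt.map W (ballNilIdeal K) (ballNilIdeal K) ε hε hεm (kernelEquivPt K W P) := by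
  apply WeierstrassCurve.Pt.ext
  rw [kernelEquivPt_apply_val, val_ptMap_eq_mapBallPt, kernelEquivPt_apply_val]
  exact zPt_galPointHom σ hσA hiso ε hεm hφ P.2

variable {p : ℕ} [Fact p.Prime]

/-- **Equivariance of the Tate-module matching**: `tateModuleToPt (T_p(σ) τ) = T_p(Pt.map ε) (tateModuleToPt τ)` — the map
`T_p E(K) → T_p Ŵ(𝔪_K)` commutes with every isometric endomorphism `σ` of `K` fixing the coefficients (for `K = ℂ_F` and `σ ∈ Γ_F`:
`Γ_F`-equivariance). [cite: SilvermanAEC2009, Prop. VII.2.2] -/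
theorem tateModuleToPt_map_galPointHom (σ : K →+* K) (hσA : ∀ a : A, σ (cK K a) = cK K a)
    (ε : unitBall K →ₐ[A] unitBall K) (hε : Continuous ε) (hεm : ∀ x ∈ (ballNilIdeal K).toIdeal, ε x ∈ (ballNilIdeal K).toIdeal)
    (hφ : ∀ x : unitBall K, σ x = ε x)
    (hss : ∀ (n : ℕ) (P : (curveOver K W).toAffine.Point), p ^ n • P = 0 →
      P ∈ kernel (NormedField.valuation (K := K)) (curveOver K W))
    (τ : TateModule (curveOver K W).toAffine.Point p) :
    tateModuleToPt W p hss (TateModule.map p (galPointHom (W := W) σ hσA) τ) =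
      TateModule.map p (WeierstrassCurve.Pt.map W (ballNilIdeal K) (ballNilIdeal K) ε hε hεm) (tateModuleToPt W p hss τ) := by
  refine TateModule.ext fun n => WeierstrassCurve.Pt.ext (Subtype.ext (Subtype.ext ?_))
  rw [coe_proj_tateModuleToPt, TateModule.proj_map, zCoord_galPointHom, TateModule.proj_map, val_ptMap_eq_mapBallPt,
    coe_mapBallPt, ← hφ, coe_proj_tateModuleToPt]

end Galois

end Literature.NumberTheory.EllipticCurves

end
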